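import Summits.BirchSwinnertonDyer.BirchSwinnertonDyer.Theorems.BiquadraticEisensteinDescentHeegnerTwistCouplingInSupplySiftedVarianceCensus
import Summits.BirchSwinnertonDyer.BirchSwinnertonDyer.Theorems.BiquadraticEisensteinDescentHeegnerTwistCouplingInSupplySqrtTwoCorner
import Summits.BirchSwinnertonDyer.BirchSwinnertonDyer.Theorems.BiquadraticEisensteinDescentHeegnerTwistCouplingInSupplyThreeSquaresPinCorner
import Literature.NumberTheory.EllipticCurves.HeegnerFieldOfDiscriminantProofs
import Literature.NumberTheory.QuadraticFields.FundamentalDiscriminant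
import Literature.NumberTheory.Sieve.RoughNumbersLargeSieve
import HarnessLib

set_option linter.dupNamespace false -- `Summit.BirchSwinnertonDyer.BirchSwinnertonDyer.Theorems.…` (summit = sub)
set_option autoImplicit false

/-!
# Crux `HeegnerTwistCouplingInSupply` (stmt-BirchSwinnertonDyer-21381), crux idea `sifted-variance-twist-census`:
# THE DOOR — the cell-free census, read in the crux's own currency on `W = B_p` for all but `o(π(Q))` primes `p ≡ 7 (16)`,
# with NO named fact

Cell `pub/bsd-wall`, width-prover seat `bsd-wall-cm-bed-w1` g19 (explicit-unit; helper for stmt-BirchSwinnertonDyer-21381,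
closes nothing). Third file of the unit (Defs `…SiftedVarianceCensusDefs` p706322, glue `…SiftedVarianceCensus`). The card's
output sentence — «for all but `o(π(Q))` primes `p ≤ Q`, `p ≡ 7 (16)`, some Heegner `d` with `|d| ≤ (log₂ Q)³` has
`L(B_p^{(d)}, 1) ≠ 0`; then `h(d) < p` for free, so `p ∤ h(d)` and the crux conclusion holds for `W = B_p` with `K′ = ℚ(√d)`»
— is made a KERNEL THEOREM here:

* §1 `window_lt_six_mul` — the window is short against the sifting range: `2¹⁶⁰ ≤ Q < p⁸ ⇒ (log₂ Q)³ < 6p`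
  (pure arithmetic: `512 (k+1)³ ≤ 6·2ᵏ` for `k ≥ 20`);
* §2 ★ `exists_heegnerField_of_mem_Dset` — ONE non-vanishing window twist gives the crux's conclusion tuple for `W = B_p`:
  for a prime `p ≥ 11`, `d ∈ D(p, y)` with `y < 6p` and `L(B_p^{(d)}, 1) ≠ 0`, the field `K′ = ℚ(√d)` (tree `sqrtField d`) is
  imaginary quadratic with `d_{K′} = d`, `|d_{K′}| > 4`, satisfies the Heegner hypothesis for `N(B_p)` (support `⊆ {2, p}` by the
  tree's modularity-free `…SqrtTwoCorner.eq_two_or_eq_of_prime_dvd_conductorNorm_B`; `2`, `p` split from `d ≡ 1 (8)`, `(d/p) = 1`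
  via `satisfiesHeegnerHypothesis_sqrtField_of_squarefree_natAbs`; `d` squarefree as an odd field discriminant,
  `Quadratic.isFundamentalDiscriminant_discr`), `L(B_p^{(d_{K′})}, 1) ≠ 0`, and `h(K′) < p` (size lever
  `…ThreeSquaresPinCorner.classNumber_lt_of_natAbs_discr_lt_six_mul`, Oesterlé), so `p ∤ h(K′)` — NO named fact is used;
* §3 ★★ `card_noHeegnerWitness_le_of_census` — `CellFreeCensus ⇒` for every `ε > 0` and all large `Q`, all but at most
  `ε Q / log Q` primes `p ≤ Q`, `p ≡ 7 (16)` admit a field `K′` with EXACTLY the conclusion of `HeegnerTwistCouplingInSupply`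
  for `W = B_p` (and `|d_{K′}| ≤ (log₂ Q)³`); ★★ `card_noHeegnerWitness_le_of_siftedMoments` — the same from the card's
  analytic input `SiftedMoments A` alone (through the glue `censusOfMoments`).

* §4 (appended) `sifted_subset_roughIcc`, ★ `card_sifted_le_explicit` (`#sifted(Q) ≤ 32 Q/log Q`, `Q ≥ 256`, by the tree's
  explicit large-sieve rough-number bound `ArithmeticLargeSieve.card_roughIcc_le_largeSieve`), ★ `card_exceptional_le_explicit`
  (`#exceptional(Q) ≤ 96 ε Q/log Q + ⌊Q^{1/8}⌋` at every height `Q ≥ 256` where the two moment inequalities hold with `ε`).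

HONEST LIMITS: rung-level (corner `j = 8000`, class `p ≡ 7 (16)`), density-one in `p` — NOT the `∀ (W, p)` crux, whose `∀ B`
supply of Heegner fields is not produced either (one `K′` per good `p`); the analytic input `SiftedMoments` is RESEARCH and
untouched; the crux stmt-21381 (C⁺) and BSD are NOT proved; nothing is closed. THEOREMS ONLY; standard axioms; no named
fact enters any theorem of this file. Supports stmt-BirchSwinnertonDyer-21381.
-/

noncomputable section

open scoped Classical

open Literature.NumberTheory.EllipticCurves Literature.NumberTheory.QuadraticFields
open Summit.BirchSwinnertonDyer.BirchSwinnertonDyer.Theorems.BiquadraticEisensteinDescentHeegnerTwistCouplingInSupplySqrtTwoCorner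
  (isElliptic_Bfam eq_two_or_eq_of_prime_dvd_conductorNorm_B)
open Summit.BirchSwinnertonDyer.BirchSwinnertonDyer.Theorems.BiquadraticEisensteinDescentHeegnerTwistCouplingInSupplyThreeSquaresPinCorner
  (classNumber_lt_of_natAbs_discr_lt_six_mul)

namespace Summit.BirchSwinnertonDyer.BirchSwinnertonDyer.Theorems.SiftedVarianceCensus

/-! ## §1 The window `(log₂ Q)³` is short: `Q < p⁸ ⇒ (log₂ Q)³ < 6p` once `Q ≥ 2¹⁶⁰` -/

/-- `512 (k + 1)³ ≤ 6 · 2ᵏ` for `k ≥ 20`. -/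
theorem mul_succ_pow_three_le_two_pow {k : ℕ} (hk : 20 ≤ k) : 512 * (k + 1) ^ 3 ≤ 6 * 2 ^ k := by
  induction k, hk using Nat.le_induction with
  | base => norm_num
  | succ k hk ih =>
    have h1 : (k + 2) ^ 3 ≤ 2 * (k + 1) ^ 3 := by
      have hk3 : 3 ≤ k := by omega
      have hkk : 9 * k ≤ k * k * k := by
        calc 9 * k = 3 * 3 * k := by ring
          _ ≤ k * k * k := Nat.mul_le_mul (Nat.mul_le_mul hk3 hk3) le_rfl
      nlinarith [hkk]
    calc 512 * (k + 1 + 1) ^ 3 = 512 * (k + 2) ^ 3 := by ring_nf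
      _ ≤ 512 * (2 * (k + 1) ^ 3) := Nat.mul_le_mul_left _ h1
      _ = 2 * (512 * (k + 1) ^ 3) := by ring
      _ ≤ 2 * (6 * 2 ^ k) := Nat.mul_le_mul_left _ ih
      _ = 6 * 2 ^ (k + 1) := by ring

/-- **The window is short against the sifting range**: if `2¹⁶⁰ ≤ Q < p⁸` then `window Q = (Nat.log 2 Q)³ < 6p`.
(With `L = Nat.log 2 Q`, `k = ⌊L/8⌋ ≥ 20`: `2ᵏ < p` since `2^{8k} ≤ 2^L ≤ Q < p⁸`, and `L³ < (8(k+1))³ = 512(k+1)³ ≤ 6·2ᵏ`.) -/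
theorem window_lt_six_mul {Q p : ℕ} (hQ : 2 ^ 160 ≤ Q) (hp : Q < p ^ 8) : window Q < 6 * p := by
  set L := Nat.log 2 Q with hL
  have hQ0 : Q ≠ 0 := by
    have : 0 < 2 ^ 160 := Nat.pos_of_ne_zero (by positivity)
    omega
  have hL160 : 160 ≤ L := Nat.le_log_of_pow_le (by norm_num) hQ
  have h2L : 2 ^ L ≤ Q := Nat.pow_log_le_self 2 hQ0
  set k := L / 8 with hk
  have hk20 : 20 ≤ k := by omega
  have hLk : L < 8 * (k + 1) := by omega
  have h1 : (2 ^ k) ^ 8 ≤ Q :=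
    calc (2 ^ k) ^ 8 = 2 ^ (8 * k) := by rw [← pow_mul, mul_comm]
      _ ≤ 2 ^ L := Nat.pow_le_pow_right (by norm_num) (by omega)
      _ ≤ Q := h2L
  have h2 : 2 ^ k < p := by
    by_contra h
    have h' := Nat.pow_le_pow_left (not_lt.1 h) 8
    omega
  calc window Q = L ^ 3 := rfl
    _ < (8 * (k + 1)) ^ 3 := Nat.pow_lt_pow_left hLk (by norm_num)
    _ = 512 * (k + 1) ^ 3 := by ring
    _ ≤ 6 * 2 ^ k := mul_succ_pow_three_le_two_pow hk20
    _ < 6 * p := by omega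

/-! ## §2 ★ One non-vanishing window twist gives the crux's conclusion for `W = B_p` (no named fact) -/

/-- ★ **The Heegner field of a good window discriminant.** Let `p ≥ 11` be prime and `d ∈ D(p, y)` (a fundamental
discriminant `−y ≤ d ≤ −7`, `d ≡ 1 (8)`, `(d/p) = 1`) with `y < 6p` and `L(B_p^{(d)}, 1) ≠ 0`. Then `K′ = ℚ(√d)` is an
imaginary quadratic field with `d_{K′} = d`, `|d_{K′}| > 4`, the Heegner hypothesis for `N(B_p)` (every prime of the
conductor is `2` or `p`, both split), `L(B_p^{(d_{K′})}, 1) ≠ 0`, `h(K′) < p` and `p ∤ h(K′)` — the conclusion of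
`HeegnerTwistCouplingInSupply` for `W = B_p`, with the class-number bound in the sharper form `h < p`. Inputs, all PROVED in
the tree: `Quadratic.isFundamentalDiscriminant_discr` (an odd field discriminant is squarefree),
`isImaginaryQuadratic_and_discr_sqrtField_of_squarefree_natAbs`, `satisfiesHeegnerHypothesis_sqrtField_of_squarefree_natAbs`,
`…SqrtTwoCorner.eq_two_or_eq_of_prime_dvd_conductorNorm_B` (good reduction away from `2p`, no modularity),
`…ThreeSquaresPinCorner.classNumber_lt_of_natAbs_discr_lt_six_mul` (Oesterlé's `h ≤ π⁻¹ √|d| log|d|` range + the table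
below `70`). [cite: Oesterle1988Gauss, II §3 Proposition p. 57 (27)] [cite: SilvermanATAEC1994, Thm. IV.10.2(a)] -/
theorem exists_heegnerField_of_mem_Dset {p y : ℕ} (hp : p.Prime) (hp11 : 11 ≤ p) {d : ℤ} (hd : d ∈ Dset p y)
    (hy : y < 6 * p) (hL : Lval p d ≠ 0) :
    ∃ (K : Type) (_ : Field K) (_ : NumberField K),
      IsImaginaryQuadratic K ∧ NumberField.discr K = d ∧ 4 < (NumberField.discr K).natAbs ∧
      SatisfiesHeegnerHypothesis ((Bp p).conductorNorm ℤ) K ∧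
      ((Bp p).quadraticTwist (NumberField.discr K : ℚ)).entireLFunction 1 ≠ 0 ∧
      NumberField.classNumber K < p ∧ ¬ p ∣ NumberField.classNumber K := by
  rw [Dset, Finset.mem_filter, Finset.mem_Icc] at hd
  obtain ⟨⟨hdy, hd7⟩, ⟨K₀, _, _, hK₀, hdK₀⟩, hd8, hjac⟩ := hd
  -- `d` is squarefree: it is the (odd) discriminant of the quadratic field `K₀`
  have hsf : Squarefree d := by
    rw [← hdK₀]
    rcases Quadratic.isFundamentalDiscriminant_discr (K := K₀) hK₀.1 with ⟨-, hsq, -⟩ | ⟨h4, -, -⟩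
    · exact hsq
    · exfalso
      obtain ⟨e, he⟩ := h4
      omega
  have hsf' : Squarefree d.natAbs := Int.squarefree_natAbs.mpr hsf
  haveI : Fact (d < 0) := ⟨by omega⟩
  obtain ⟨hK, hdK⟩ := isImaginaryQuadratic_and_discr_sqrtField_of_squarefree_natAbs d (by omega) hsf'
  have h4 : 4 < (NumberField.discr (sqrtField d)).natAbs := by rw [hdK]; omega
  have hlt : (NumberField.discr (sqrtField d)).natAbs < 6 * p := by rw [hdK]; omega
  have hcl : NumberField.classNumber (sqrtField d) < p := classNumber_lt_of_natAbs_discr_lt_six_mul hK h4 hp11 hlt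
  haveI hE : (⟨0, 4 * (p : ℚ), 0, 2 * (p : ℚ) ^ 2, 0⟩ : WeierstrassCurve ℚ).IsElliptic :=
    isElliptic_Bfam (by exact_mod_cast hp.ne_zero)
  refine ⟨sqrtField d, inferInstance, inferInstance, hK, hdK, h4, ?_, ?_, hcl, fun hdvd =>
    absurd (Nat.le_of_dvd (NumberField.classNumber_pos _) hdvd) (not_le.mpr hcl)⟩
  · refine satisfiesHeegnerHypothesis_sqrtField_of_squarefree_natAbs d hd8 hsf' fun q hq hqN => ?_
    rcases eq_two_or_eq_of_prime_dvd_conductorNorm_B hp hq hqN with rfl | rfl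
    · exact Or.inl rfl
    · exact Or.inr (hjac q hq dvd_rfl)
  · rw [hdK]
    intro h
    exact hL (by rw [Lval, h, norm_zero])

/-- The same door at census height `Q`: a prime `p ≥ 11` with `Q < p⁸` (i.e. `p > r(Q)`), `Q ≥ 2¹⁶⁰`, that is NOT exceptional
(some `d` of its window `D(p, (log₂ Q)³)` has `L(B_p^{(d)}, 1) ≠ 0`) admits a Heegner field with the crux's conclusion for
`W = B_p` and `|d_{K′}| ≤ (log₂ Q)³`. -/
theorem exists_heegnerField_of_not_forall {Q p : ℕ} (hp : p.Prime) (hp11 : 11 ≤ p) (hQ : 2 ^ 160 ≤ Q) (hpQ : Q < p ^ 8)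
    (hne : ¬ ∀ d ∈ Dset p (window Q), Lval p d = 0) :
    ∃ (K : Type) (_ : Field K) (_ : NumberField K),
      IsImaginaryQuadratic K ∧ (NumberField.discr K).natAbs ≤ window Q ∧ 4 < (NumberField.discr K).natAbs ∧
      SatisfiesHeegnerHypothesis ((Bp p).conductorNorm ℤ) K ∧
      ((Bp p).quadraticTwist (NumberField.discr K : ℚ)).entireLFunction 1 ≠ 0 ∧
      NumberField.classNumber K < p ∧ ¬ p ∣ NumberField.classNumber K := by
  push Not at hne
  obtain ⟨d, hd, hL⟩ := hne
  obtain ⟨K, _, _, hK, hdK, h4, hH, hL', hcl, hndvd⟩ :=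
    exists_heegnerField_of_mem_Dset hp hp11 hd (window_lt_six_mul hQ hpQ) hL
  have hdw : (NumberField.discr K).natAbs ≤ window Q := by
    rw [Dset, Finset.mem_filter, Finset.mem_Icc] at hd
    rw [hdK]; omega
  exact ⟨K, inferInstance, inferInstance, hK, hdw, h4, hH, hL', hcl, hndvd⟩

/-! ## §3 ★★ The census in the crux's currency: all but `o(π(Q))` primes `p ≡ 7 (16)` carry a Heegner witness for `B_p` -/

/-- ★★ **The cell-free census in the currency of the crux.** If `CellFreeCensus` holds then for every `ε > 0` and all large
`Q`, the primes `p ≤ Q`, `p ≡ 7 (16)` for which NO imaginary quadratic `K′` with `|d_{K′}| ≤ (log₂ Q)³`, `|d_{K′}| > 4`, the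
Heegner hypothesis for `N(B_p)`, `L(B_p^{(d_{K′})}, 1) ≠ 0` and `p ∤ h(K′)` exists number at most `ε Q / log Q`: the bad primes
`> r(Q) = ⌊Q^{1/8}⌋` are exceptional (§2), and those `≤ r(Q)` (or `< 11`) are `≤ r(Q) ≤ (ε/2) Q / log Q`
(`sqrt_sqrt_sqrt_le_eventually`). No named fact; nothing about the `∀ p` crux or BSD is claimed. -/
theorem card_noHeegnerWitness_le_of_census (hC : CellFreeCensus) :
    ∀ ε : ℝ, 0 < ε → ∃ Q₀ : ℕ, ∀ Q : ℕ, Q₀ ≤ Q →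
      ((((Finset.Icc 1 Q).filter (fun p => p.Prime ∧ p % 16 = 7 ∧
          ¬ ∃ (K : Type) (_ : Field K) (_ : NumberField K),
              IsImaginaryQuadratic K ∧ (NumberField.discr K).natAbs ≤ window Q ∧ 4 < (NumberField.discr K).natAbs ∧
              SatisfiesHeegnerHypothesis ((Bp p).conductorNorm ℤ) K ∧
              ((Bp p).quadraticTwist (NumberField.discr K : ℚ)).entireLFunction 1 ≠ 0 ∧
              ¬ p ∣ NumberField.classNumber K)).card : ℕ) : ℝ) ≤ ε * Q / Real.log Q := by
  intro ε hε
  obtain ⟨Q₁, hQ₁⟩ := hC (ε / 2) (half_pos hε)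
  obtain ⟨Q₂, hQ₂⟩ := sqrt_sqrt_sqrt_le_eventually (half_pos hε)
  refine ⟨max Q₁ (max Q₂ (2 ^ 160)), fun Q hQ => ?_⟩
  have hQ1 : Q₁ ≤ Q := le_trans (le_max_left _ _) hQ
  have hQ2 : Q₂ ≤ Q := le_trans (le_trans (le_max_left _ _) (le_max_right _ _)) hQ
  have hQ3 : 2 ^ 160 ≤ Q := le_trans (le_trans (le_max_right _ _) (le_max_right _ _)) hQ
  set r := Nat.sqrt (Nat.sqrt (Nat.sqrt Q)) with hr
  -- `r ≥ 11` (as `11⁸ ≤ 2¹⁶⁰ ≤ Q`)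
  have hr11 : 11 ≤ r := (le_sqrt_sqrt_sqrt_iff 11 Q).2 (le_trans (by norm_num) hQ3)
  set E := (Finset.Icc 1 Q).filter (fun p => p.Prime ∧ p % 16 = 7 ∧ ∀ d ∈ Dset p (window Q), Lval p d = 0) with hE
  set B := (Finset.Icc 1 Q).filter (fun p => p.Prime ∧ p % 16 = 7 ∧
          ¬ ∃ (K : Type) (_ : Field K) (_ : NumberField K),
              IsImaginaryQuadratic K ∧ (NumberField.discr K).natAbs ≤ window Q ∧ 4 < (NumberField.discr K).natAbs ∧
              SatisfiesHeegnerHypothesis ((Bp p).conductorNorm ℤ) K ∧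
              ((Bp p).quadraticTwist (NumberField.discr K : ℚ)).entireLFunction 1 ≠ 0 ∧
              ¬ p ∣ NumberField.classNumber K) with hB
  -- bad primes above `r` are exceptional; the others are `≤ r`
  have hsub : B ⊆ E ∪ Finset.Icc 1 r := by
    intro p hp
    rw [hB, Finset.mem_filter, Finset.mem_Icc] at hp
    obtain ⟨⟨hp1, hpQ⟩, hpp, hp16, hno⟩ := hp
    rw [Finset.mem_union, Finset.mem_Icc]
    by_cases hrp : r < p
    · left
      rw [hE, Finset.mem_filter, Finset.mem_Icc]
      refine ⟨⟨hp1, hpQ⟩, hpp, hp16, ?_⟩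
      by_contra hall
      have hpQ8 : Q < p ^ 8 := by
        by_contra h8
        exact absurd ((le_sqrt_sqrt_sqrt_iff p Q).2 (not_lt.1 h8)) (not_le.2 hrp)
      obtain ⟨K, _, _, hK, hdw, h4, hH, hL', -, hndvd⟩ :=
        exists_heegnerField_of_not_forall hpp (le_trans hr11 hrp.le) hQ3 hpQ8 hall
      exact hno ⟨K, inferInstance, inferInstance, hK, hdw, h4, hH, hL', hndvd⟩
    · right
      exact ⟨hp1, not_lt.1 hrp⟩
  have hcard : (B.card : ℝ) ≤ (E.card : ℝ) + r := by
    have h := (Finset.card_le_card hsub).trans (Finset.card_union_le _ _)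
    rw [Nat.card_Icc, Nat.add_sub_cancel] at h
    exact_mod_cast h
  calc (B.card : ℝ) ≤ (E.card : ℝ) + r := hcard
    _ ≤ ε / 2 * Q / Real.log Q + ε / 2 * Q / Real.log Q := add_le_add (hQ₁ Q hQ1) (hQ₂ Q hQ2)
    _ = ε * Q / Real.log Q := by ring

/-- ★★ **The whole chain of the card, kernel-checked modulo its analytic input only**: the sifted first + mixed second
moment `SiftedMoments A` (RESEARCH, the card's K1 + K2) implies, for every `ε > 0` and all large `Q`, that all but at most
`ε Q / log Q` primes `p ≤ Q`, `p ≡ 7 (16)` admit a Heegner field `K′` with `|d_{K′}| ≤ (log₂ Q)³` carrying EXACTLY the conclusion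
of `HeegnerTwistCouplingInSupply` for `W = B_p`. Composition of `censusOfMoments` (glue file) and
`card_noHeegnerWitness_le_of_census`. The `∀ p` crux, its `∀ B` supply, and BSD are NOT touched. -/
theorem card_noHeegnerWitness_le_of_siftedMoments {A : ℝ} (hA : 0 < A) (h : SiftedMoments A) :
    ∀ ε : ℝ, 0 < ε → ∃ Q₀ : ℕ, ∀ Q : ℕ, Q₀ ≤ Q →
      ((((Finset.Icc 1 Q).filter (fun p => p.Prime ∧ p % 16 = 7 ∧
          ¬ ∃ (K : Type) (_ : Field K) (_ : NumberField K),
              IsImaginaryQuadratic K ∧ (NumberField.discr K).natAbs ≤ window Q ∧ 4 < (NumberField.discr K).natAbs ∧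
              SatisfiesHeegnerHypothesis ((Bp p).conductorNorm ℤ) K ∧
              ((Bp p).quadraticTwist (NumberField.discr K : ℚ)).entireLFunction 1 ≠ 0 ∧
              ¬ p ∣ NumberField.classNumber K)).card : ℕ) : ℝ) ≤ ε * Q / Real.log Q :=
  card_noHeegnerWitness_le_of_census (cellFreeCensus_of_siftedMoments hA h)

/-! ## §4 (appended) Explicit constants: `#sifted(Q) ≤ 32 Q / log Q` by the large sieve, and the explicit census -/

/-- The sifted moduli are `(r(Q)+1)`-rough: `sifted Q ⊆ roughIcc (r(Q)+1) Q` (tree `Literature.NumberTheory.Sieve.roughIcc`). -/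
theorem sifted_subset_roughIcc (Q : ℕ) :
    sifted Q ⊆ Literature.NumberTheory.Sieve.roughIcc (Nat.sqrt (Nat.sqrt (Nat.sqrt Q)) + 1) Q := by
  intro m hm
  have h := (mem_sifted_iff Q m).1 hm
  rw [Literature.NumberTheory.Sieve.mem_roughIcc]
  exact ⟨h.1, fun p hp hpm => h.2.2.2 p hp hpm⟩

/-- ★ **Explicit sieve count**: `#sifted(Q) ≤ 32 · Q / log Q` for all `Q ≥ 256` — the constant-free `∃ C` of `card_sifted_le`
made explicit by the tree's large-sieve bound for rough numbers
`Literature.NumberTheory.Sieve.ArithmeticLargeSieve.card_roughIcc_le_largeSieve` (`#roughIcc (X+1) t ≤ (t − 1 + X²)/log X`,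
Montgomery / Bateman–Diamond Thm 12.9) with `X = r(Q) = ⌊Q^{1/8}⌋ ≥ 2`: `r² ≤ Q` and `log Q < 8 log(2r) ≤ 16 log r`.
[cite: BatemanDiamond2004, Thm 12.9, §12.5 p. 302] -/
theorem card_sifted_le_explicit {Q : ℕ} (hQ : 256 ≤ Q) : ((sifted Q).card : ℝ) ≤ 32 * Q / Real.log Q := by
  set r := Nat.sqrt (Nat.sqrt (Nat.sqrt Q)) with hr
  have hr2 : 2 ≤ r := (le_sqrt_sqrt_sqrt_iff 2 Q).2 (le_trans (by norm_num) hQ)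
  have hrR : (2 : ℝ) ≤ r := by exact_mod_cast hr2
  have hr8 : (r : ℝ) ^ 8 ≤ Q := by exact_mod_cast sqrt_sqrt_sqrt_pow_eight_le Q
  have hQlt' : Q < (r + 1) ^ 8 := by
    by_contra h
    have := (le_sqrt_sqrt_sqrt_iff _ Q).2 (not_lt.1 h)
    omega
  have hQlt : (Q : ℝ) < ((r : ℝ) + 1) ^ 8 := by exact_mod_cast hQlt'
  have hQR : (256 : ℝ) ≤ Q := by exact_mod_cast hQ
  have hlogQ : 0 < Real.log Q := Real.log_pos (by linarith)
  have hlogr : 0 < Real.log r := Real.log_pos (by linarith)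
  -- `log Q ≤ 16 log r`: `Q < (r+1)⁸ ≤ (2r)⁸ = 2⁸ r⁸ ≤ r⁸ · r⁸` since `r ≥ 2`
  have hlog : Real.log Q ≤ 16 * Real.log r := by
    have h1 : ((r : ℝ) + 1) ^ 8 ≤ (2 * r) ^ 8 := pow_le_pow_left₀ (by linarith) (by linarith) 8
    have h2 : ((2 : ℝ) * r) ^ 8 = 2 ^ 8 * (r : ℝ) ^ 8 := by ring
    have h3 : (2 : ℝ) ^ 8 ≤ (r : ℝ) ^ 8 := pow_le_pow_left₀ (by norm_num) hrR 8
    have h4 : (Q : ℝ) ≤ (r : ℝ) ^ 16 := by nlinarith [pow_nonneg (show (0:ℝ) ≤ r by linarith) 8]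
    have h5 := Real.log_le_log (by linarith) h4
    rw [Real.log_pow] at h5
    push_cast at h5
    linarith
  have hr2Q : (r : ℝ) ^ 2 ≤ Q := le_trans (pow_le_pow_right₀ (by linarith) (by norm_num : 2 ≤ 8)) hr8
  have hmain := Literature.NumberTheory.Sieve.ArithmeticLargeSieve.card_roughIcc_le_largeSieve r Q hr2
  calc ((sifted Q).card : ℝ)
      ≤ ((Literature.NumberTheory.Sieve.roughIcc (r + 1) Q).card : ℝ) := by
        exact_mod_cast Finset.card_le_card (sifted_subset_roughIcc Q)
    _ ≤ ((Q : ℝ) - 1 + (r : ℝ) ^ 2) / Real.log r := hmain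
    _ ≤ 2 * Q / Real.log r := by
        apply div_le_div_of_nonneg_right _ hlogr.le
        linarith
    _ ≤ 2 * Q / (Real.log Q / 16) := by
        apply div_le_div_of_nonneg_left (by positivity) (by positivity)
        linarith
    _ = 32 * Q / Real.log Q := by
        field_simp
        ring

/-- ★ **The explicit census**: at every height `Q ≥ 256` where the two moment inequalities of `SiftedMoments` hold with `ε`,
`#exceptional(Q) ≤ 96 ε · Q / log Q + ⌊Q^{1/8}⌋` (from `card_exceptional_le_of_moments` and `card_sifted_le_explicit`). -/
theorem card_exceptional_le_explicit {A ε : ℝ} (hε : 0 ≤ ε) {Q : ℕ} (hQ : 256 ≤ Q)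
    (h1 : |∑ m ∈ sifted Q, (S m (window Q) / (A * (Dset m (window Q)).card) - 1)| ≤ ε * (sifted Q).card)
    (h2 : ∑ m ∈ sifted Q, (S m (window Q) / (A * (Dset m (window Q)).card)) ^ 2 ≤ (1 + ε) * (sifted Q).card) :
    ((((Finset.Icc 1 Q).filter
        (fun p => p.Prime ∧ p % 16 = 7 ∧ ∀ d ∈ Dset p (window Q), Lval p d = 0)).card : ℕ) : ℝ) ≤
      96 * ε * Q / Real.log Q + Nat.sqrt (Nat.sqrt (Nat.sqrt Q)) := by
  have hE := card_exceptional_le_of_moments h1 h2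
  have hS := card_sifted_le_explicit hQ
  have : 3 * ε * ((sifted Q).card : ℝ) ≤ 96 * ε * Q / Real.log Q := by
    calc 3 * ε * ((sifted Q).card : ℝ) ≤ 3 * ε * (32 * Q / Real.log Q) :=
          mul_le_mul_of_nonneg_left hS (by positivity)
      _ = 96 * ε * Q / Real.log Q := by ring
  linarith

end Summit.BirchSwinnertonDyer.BirchSwinnertonDyer.Theorems.SiftedVarianceCensus

end
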